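import Summits.Langlands.Langlands.Theorems.SqrtFiveQuarticCoversW5DescentClasses
import HarnessLib

/-!
# Route `Langlands/SqrtFiveQuarticCovers`, sheet 4.5 (`CertB3E7`, stmt-Langlands-23416), row 8:
# **`hQ5` AS A KERNEL THEOREM** — the rational points of `W⁵ : Y² = X³ + 1470X² − 8575X`
# (the `5`-twist of Cremona `49a4`, conductor `1225 = 5²·7²`) are `O` and `T = (0, 0)`

Cell lg-quartmod (F-L1), seat eng-7 g5; module 4/4 (after `…W5DescentLocal`, `…W5DescentCurve`, `…W5DescentClasses`).  MAIN THEOREM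

* `W5Descent.ratPoints : ∀ X Y : ℚ, Y ^ 2 = X ^ 3 + 1470 * X ^ 2 - 8575 * X → X = 0`

— CHARACTER-FOR-CHARACTER the hypothesis `hQ5` of
`Theorems/SqrtFiveQuarticCoversCertB3E7MordellWeilQ.lean` (p677449, eng-8 g3:
`mordellWeilE7_of_ratPoints (hQ) (hQ5)` = the registered stub `MordellWeilE7` VERBATIM;
`certB3E7_of_modelIdentificationInf_of_ratPoints (hK1inf) (hQ) (hQ5) : CertB3E7`).  With this file
the named input `hQ5` («`1225.c1(ℚ) ≅ ℤ/2`», of DATABASE kind — Cremona's printed Table 1 stops at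
`N = 1000`) is DISCHARGED: no hypothesis, standard axioms.  The companion `hQ` (`49a4(ℚ) ≅ ℤ/2`)
is eng-8 g3's E7-MW-FERMAT item (lead GO 23:34:25Z); together they close `MordellWeilE7` by name.

PROOF (verbatim the method of `Literature/NumberTheory/EllipticCurves/Curve49A1Points.lean`,
`X1FourteenMordellWeil.lean`, `KubertTwoTenProofs.lean`; Silverman–Tate III.4–III.6, *AEC* X.4.9,
VII.3.1/VII.3.4, VIII.6.7):
1. **rank `0`**: `W⁵(ℚ)` is finite (`W5Descent.finite_point`, module 2: descent via `2`-isogeny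
   with the six local certificates of `…W5DescentLocal.lean`, and the tree's PROVED Mordell–Weil theorem);
   `W⁵(ℚ) = 2W⁵(ℚ) + {O, T}` (`exists_eq_add_self_or`).
2. **torsion**: `T` is the only rational `2`-torsion point (`(X + 735)² = 548800 = 2⁶·5²·7³` has
   no rational root) and `2Q ≠ T` for every `Q` (duplication `x(2Q)·(2y)² = (x² + 8575)²`, and
   `x² + 8575 > 0`), so `2Q` has odd order for every `Q`.  An odd-order point `P₀ = (x₀, y₀) ≠ O`
   has `p`-integral `x₀` at every prime (`norm_le_one_of_odd`: *AEC* VII.3.1 at `p = 2` via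
   `val_le_one_of_zsmul_eq_zero`, VII.3.4 at odd `p` via
   `not_isOfFinAddOrder_of_one_lt_padicNorm_of_isIntegral`), `x₀ = w²` by the duplication formula
   (`P₀ = 2Q`), so `w ∈ ℤ` and `v = y₀/w ∈ ℤ` with `v² = w⁴ + 1470w² − 8575`; the SAME applies to
   `2P₀` (again of odd order), whose abscissa `((x₀² + 8575)/(2y₀))² = ((w⁴ + 8575)/(2vw))²` is
   integral, so `2vw·t = w⁴ + 8575` with `t ∈ ℤ` and **`w ∣ 8575 = 5²·7³`**: twelve values
   `|w| ∈ {1, 5, 7, 25, 35, 49, 175, 245, 343, 1225, 1715, 8575}`, for none of which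
   `w⁴ + 1470w² − 8575` is a square (`< 0` for `|w| = 1`; strictly between consecutive squares
   otherwise, `quartic_ne_sq_of_dvd` in `…W5DescentCurve.lean`).  So there is no odd-order point but `O`.
3. Every point is `2Q = O` or `2Q + T = T`; affine points have `X = 0`.

HONEST STATUS: an unconditional kernel theorem about `E(ℚ)` of ONE explicit elliptic curve over `ℚ`
(conductor `1225`); it is not a modularity or BSD statement; nothing here proves modularity of a new
class of elliptic curves.  References: [SilvermanAEC2009] III.2.3(d), VII.3.1, VII.3.4, VIII.6.7,
X.4.9; J. E. Cremona, *Algorithms for Modular Elliptic Curves* (1997) (the method `mwrank`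
implements; `N = 1225` is beyond the printed Table 1) [CremonaAlgorithms1997].
-/

noncomputable section

open scoped Classical NNReal

set_option linter.dupNamespace false -- project-wide option; `Summit.Langlands.Langlands` is the mandated namespace

namespace Summit.Langlands.Langlands.Theorems.SqrtFiveQuarticCovers.W5Descent

open Literature.NumberTheory.EllipticCurves _root_.WeierstrassCurve
  Literature.NumberTheory.EllipticCurves.KramerTwoDescent

/-! ### The group law on `W⁵(ℚ)` in coordinates -/

/-- `-(x, y) = (x, -y)` on `W⁵` (`a₁ = a₃ = 0`). [folklore] -/
theorem negY_eq (x y : ℚ) :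
    (⟨0, 1470, 0, -8575, 0⟩ : WeierstrassCurve ℚ).toAffine.negY x y = -y := by
  rw [Affine.negY, toAffine_a₁, toAffine_a₃]; ring

/-- The curve equation from nonsingularity. [folklore] -/
theorem rel {x y : ℚ} (h : (⟨0, 1470, 0, -8575, 0⟩ : WeierstrassCurve ℚ).toAffine.Nonsingular x y) :
    y ^ 2 = x ^ 3 + 1470 * x ^ 2 - 8575 * x :=
  (equation_iff x y).mp h.1

/-- **The only rational `2`-torsion point of `W⁵` is `T = (0, 0)`**: the other roots of
`X³ + 1470X² − 8575X` satisfy `(X + 735)² = 548800`, which has no rational solution. [folklore] -/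
theorem eq_T_of_add_self {P : (⟨0, 1470, 0, -8575, 0⟩ : WeierstrassCurve ℚ).toAffine.Point}
    (h2 : P + P = 0) (h0 : P ≠ 0) :
    P = (Affine.Point.some 0 0 nonsingular_T :
      (⟨0, 1470, 0, -8575, 0⟩ : WeierstrassCurve ℚ).toAffine.Point) := by
  rcases P with _ | ⟨x, y, h⟩
  · exact absurd rfl h0
  have hy : y = (⟨0, 1470, 0, -8575, 0⟩ : WeierstrassCurve ℚ).toAffine.negY x y := by
    by_contra hy
    rw [Affine.Point.add_self_of_Y_ne hy] at h2
    exact Affine.Point.some_ne_zero _ h2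
  rw [negY_eq] at hy
  have hy0 : y = 0 := by linarith
  have e := rel h
  rw [hy0] at e
  have hx : x * ((x + 735) ^ 2 - 548800) = 0 := by linear_combination -e
  rcases mul_eq_zero.mp hx with hx0 | hx0
  · subst hx0 hy0; rfl
  · exfalso
    have hsq : (x + 735) ^ 2 = ((548800 : ℤ) : ℚ) := by push_cast; linear_combination hx0
    have hden : (x + 735).den = 1 := Rat.den_eq_one_of_sq_eq_intCast hsq
    have hZ : (((x + 735).num : ℤ) : ℚ) = x + 735 := Rat.coe_int_num_of_den_eq_one hden
    have : ((x + 735).num : ℤ) ^ 2 = 548800 := by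
      have h' : ((((x + 735).num : ℤ) : ℚ)) ^ 2 = ((548800 : ℤ) : ℚ) := by rw [hZ, hsq]
      exact_mod_cast h'
    exact int_sq_ne_548800 _ this

/-- **Duplication on `W⁵`**: `x(2P) · (2y)² = (x² + 8575)²` for `P = (x, y)` with `y ≠ 0`
(Silverman, *AEC*, III.2.3(d) with `a = 1470`, `b = −8575`). [folklore] -/
theorem addX_self_mul {x y : ℚ}
    (h : (⟨0, 1470, 0, -8575, 0⟩ : WeierstrassCurve ℚ).toAffine.Nonsingular x y)
    (hy : y ≠ (⟨0, 1470, 0, -8575, 0⟩ : WeierstrassCurve ℚ).toAffine.negY x y) :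
    (⟨0, 1470, 0, -8575, 0⟩ : WeierstrassCurve ℚ).toAffine.addX x x
        ((⟨0, 1470, 0, -8575, 0⟩ : WeierstrassCurve ℚ).toAffine.slope x x y y) * (2 * y) ^ 2 =
      (x ^ 2 + 8575) ^ 2 := by
  have e := rel h
  have hy2 : y - (⟨0, 1470, 0, -8575, 0⟩ : WeierstrassCurve ℚ).toAffine.negY x y = 2 * y := by
    rw [negY_eq]; ring
  have hℓ : (⟨0, 1470, 0, -8575, 0⟩ : WeierstrassCurve ℚ).toAffine.slope x x y y * (2 * y) =
      3 * x ^ 2 + 2940 * x - 8575 := by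
    rw [Affine.slope_of_Y_ne rfl hy, hy2, toAffine_a₁, toAffine_a₂, toAffine_a₄,
      div_mul_cancel₀ _ (by rw [← hy2]; exact sub_ne_zero.mpr hy)]
    ring
  set ℓ := (⟨0, 1470, 0, -8575, 0⟩ : WeierstrassCurve ℚ).toAffine.slope x x y y
  rw [Affine.addX, toAffine_a₁, toAffine_a₂]
  linear_combination (2 * y * ℓ + (3 * x ^ 2 + 2940 * x - 8575)) * hℓ + 4 * (-1470 - 2 * x) * e

/-- **No rational point `Q` with `2Q = T`** on `W⁵`: by the duplication formula `x(2Q) = 0` would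
force `x² + 8575 = 0`. [folklore] -/
theorem add_self_ne_T (Q : (⟨0, 1470, 0, -8575, 0⟩ : WeierstrassCurve ℚ).toAffine.Point) :
    Q + Q ≠ (Affine.Point.some 0 0 nonsingular_T :
      (⟨0, 1470, 0, -8575, 0⟩ : WeierstrassCurve ℚ).toAffine.Point) := by
  intro hQ
  rcases Q with _ | ⟨x, y, h⟩
  · rw [← Affine.Point.zero_def, add_zero] at hQ
    exact (Affine.Point.some_ne_zero _) hQ.symm
  by_cases hy : y = (⟨0, 1470, 0, -8575, 0⟩ : WeierstrassCurve ℚ).toAffine.negY x y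
  · rw [Affine.Point.add_self_of_Y_eq hy] at hQ
    exact (Affine.Point.some_ne_zero _) hQ.symm
  · have key := addX_self_mul h hy
    rw [Affine.Point.add_self_of_Y_ne hy, Affine.Point.some.injEq] at hQ
    rw [hQ.1, zero_mul] at key
    have : x ^ 2 + 8575 = 0 := pow_eq_zero_iff two_ne_zero |>.mp key.symm
    nlinarith [sq_nonneg x]

/-! ### The rational points of `W⁵` -/

/-- **`W⁵(ℚ) = 2·W⁵(ℚ) + {O, T}`** with Mathlib's (decidable-equality–`ℚ`) group law: the descent
lemma `exists_eq_two_smul_or` specialised to `W⁵` (the generic files use the classical instance;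
the two group laws agree, `point_add_irrel`). [cite: SilvermanAEC2009, X.4.9] -/
theorem exists_eq_add_self_or (P : (⟨0, 1470, 0, -8575, 0⟩ : WeierstrassCurve ℚ).toAffine.Point) :
    ∃ Q : (⟨0, 1470, 0, -8575, 0⟩ : WeierstrassCurve ℚ).toAffine.Point, P = Q + Q ∨
      P = Q + Q + (Affine.Point.some 0 0 nonsingular_T :
        (⟨0, 1470, 0, -8575, 0⟩ : WeierstrassCurve ℚ).toAffine.Point) := by
  haveI := isElliptic
  obtain ⟨Q, hQ⟩ := (⟨0, 1470, 0, -8575, 0⟩ : WeierstrassCurve ℚ).exists_eq_two_smul_or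
    (fun h hx => sq_or_mul_sq h hx) (fun h hX => codomain_sq_or_mul_sq h hX) P
  refine ⟨Q, ?_⟩
  have h2 : ∀ (d : DecidableEq ℚ) (R : (⟨0, 1470, 0, -8575, 0⟩ : WeierstrassCurve ℚ).toAffine.Point),
      (letI : DecidableEq ℚ := d; (2 • R :)) = @HAdd.hAdd _ _ _ (@instHAdd _
        (@WeierstrassCurve.Affine.Point.instAdd ℚ _
          (⟨0, 1470, 0, -8575, 0⟩ : WeierstrassCurve ℚ).toAffine instDecidableEqRat)) R R := by
    intro d R
    have hd : d = instDecidableEqRat := Subsingleton.elim _ _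
    subst hd
    exact two_nsmul R
  rw [h2 _ Q] at hQ
  rcases hQ with hQ | hQ
  · exact Or.inl hQ
  · rw [point_add_irrel (fun a b => Classical.propDecidable (a = b)) instDecidableEqRat] at hQ
    exact Or.inr hQ

/-- **Odd-order rational points of `W⁵` have integral abscissa** (Nagell–Lutz style): for a
rational point `P₀ = (x₀, y₀)` of odd order, `‖x₀‖_p ≤ 1` at every prime `p` — at `p = 2` because
odd-order torsion is `2`-integral (`val_le_one_of_zsmul_eq_zero`, *AEC* VII.3.1), at odd `p`
because `E₁(ℚ_p) ∩ E(ℚ)` is torsion-free (`not_isOfFinAddOrder_of_one_lt_padicNorm_of_isIntegral`,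
*AEC* VII.3.4). [cite: SilvermanAEC2009, VII.3.4] -/
theorem norm_le_one_of_odd {x₀ y₀ : ℚ}
    {h₀ : (⟨0, 1470, 0, -8575, 0⟩ : WeierstrassCurve ℚ).toAffine.Nonsingular x₀ y₀}
    (hfin : IsOfFinAddOrder
      (.some x₀ y₀ h₀ : (⟨0, 1470, 0, -8575, 0⟩ : WeierstrassCurve ℚ).toAffine.Point))
    (hodd : Odd (addOrderOf
      (.some x₀ y₀ h₀ : (⟨0, 1470, 0, -8575, 0⟩ : WeierstrassCurve ℚ).toAffine.Point)))
    (p : ℕ) [Fact p.Prime] : ‖(x₀ : ℚ_[p])‖ ≤ 1 := by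
  haveI := isElliptic
  haveI := isIntegral
  by_cases hp2 : p = 2
  · subst hp2
    haveI : (⟨0, 1470, 0, -8575, 0⟩ : WeierstrassCurve ℚ).IsIntegral (ratAdicValuation 2).integer :=
      (⟨0, 1470, 0, -8575, 0⟩ : WeierstrassCurve ℚ).isIntegral_integer_ratAdicValuation 2
    set m := addOrderOf
      (.some x₀ y₀ h₀ : (⟨0, 1470, 0, -8575, 0⟩ : WeierstrassCurve ℚ).toAffine.Point) with hm
    have hm0 : m • (.some x₀ y₀ h₀ : (⟨0, 1470, 0, -8575, 0⟩ : WeierstrassCurve ℚ).toAffine.Point) = 0 :=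
      addOrderOf_nsmul_eq_zero _
    have hmz : (m : ℤ) •
        (.some x₀ y₀ h₀ : (⟨0, 1470, 0, -8575, 0⟩ : WeierstrassCurve ℚ).toAffine.Point) = 0 := by
      rw [natCast_zsmul]; exact hm0
    have hmz' := (point_zsmul_irrel (instDecidableEqRat)
      (fun a b => Classical.propDecidable (a = b)) (m : ℤ)
      (.some x₀ y₀ h₀ : (⟨0, 1470, 0, -8575, 0⟩ : WeierstrassCurve ℚ).toAffine.Point)).symm.trans hmz
    have hw : ratAdicValuation 2 (((m : ℕ) : ℤ) : ℚ) = 1 := by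
      rw [ratAdicValuation_apply, ← NNReal.coe_eq_one, coe_nnnorm, Int.cast_natCast,
        Rat.cast_natCast, Padic.norm_natCast_eq_one_iff]
      exact Nat.coprime_two_left.mpr hodd
    have := val_le_one_of_zsmul_eq_zero (V := (⟨0, 1470, 0, -8575, 0⟩ : WeierstrassCurve ℚ)) hw hmz'
    rw [ratAdicValuation_apply, ← NNReal.coe_le_coe, NNReal.coe_one, coe_nnnorm] at this
    exact this
  · have hp3 : 3 ≤ p := by
      have h2 := (Fact.out : p.Prime).two_le
      omega
    by_contra h1
    exact not_isOfFinAddOrder_of_one_lt_padicNorm_of_isIntegral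
      (⟨0, 1470, 0, -8575, 0⟩ : WeierstrassCurve ℚ) p hp3 h₀ (not_le.mp h1) hfin

/-- **In `W⁵(ℚ)` the double of any point has odd order**: otherwise a suitable multiple
`R = j·(2Q)` would have order `2`, so `R = T` (`eq_T_of_add_self`), i.e. `T = 2(jQ)`,
contradicting `add_self_ne_T`. [folklore] -/
theorem odd_addOrderOf_add_self [Finite (⟨0, 1470, 0, -8575, 0⟩ : WeierstrassCurve ℚ).toAffine.Point]
    (Q : (⟨0, 1470, 0, -8575, 0⟩ : WeierstrassCurve ℚ).toAffine.Point) : Odd (addOrderOf (Q + Q)) := by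
  by_contra heven
  rw [Nat.not_odd_iff_even] at heven
  obtain ⟨j, hj⟩ := heven
  have hpos : 0 < addOrderOf (Q + Q) := (isOfFinAddOrder_of_finite _).addOrderOf_pos
  have hj0 : j ≠ 0 := by rintro rfl; omega
  have hR : addOrderOf (j • (Q + Q)) = 2 := by
    rw [addOrderOf_nsmul' (Q + Q) hj0, hj, ← two_mul, Nat.gcd_mul_left_left,
      Nat.mul_div_cancel _ (Nat.pos_of_ne_zero hj0)]
  have hR0 : j • (Q + Q) ≠ 0 := by
    intro h0
    rw [h0, addOrderOf_zero] at hR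
    exact absurd hR (by norm_num)
  have hR2 : j • (Q + Q) + j • (Q + Q) = 0 := by
    rw [← two_nsmul, ← hR]; exact addOrderOf_nsmul_eq_zero _
  have hT := eq_T_of_add_self hR2 hR0
  rw [nsmul_add] at hT
  exact add_self_ne_T (j • Q) hT

/-- **An odd-order affine point `P₀ = (x₀, y₀)` of `W⁵(ℚ)` has `x₀ = w²`, `y₀ = v·w` with
`w, v ∈ ℤ`, `w ≠ 0`, `v ≠ 0` — PROVIDED `x₀` is a rational square.**  (Integrality of `x₀` from
`norm_le_one_of_odd`; `w ∈ ℤ` as a rational square root of an integer; `v = y₀/w ∈ ℤ` from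
`v² = x₀² + 1470x₀ − 8575 ∈ ℤ`.) [folklore] -/
theorem exists_int_coords_of_odd [Finite (⟨0, 1470, 0, -8575, 0⟩ : WeierstrassCurve ℚ).toAffine.Point]
    {x₀ y₀ : ℚ} {h₀ : (⟨0, 1470, 0, -8575, 0⟩ : WeierstrassCurve ℚ).toAffine.Nonsingular x₀ y₀}
    (hodd : Odd (addOrderOf
      (.some x₀ y₀ h₀ : (⟨0, 1470, 0, -8575, 0⟩ : WeierstrassCurve ℚ).toAffine.Point)))
    (hx₀ : x₀ ≠ 0) {w : ℚ} (hsq : x₀ = w ^ 2) :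
    ∃ W V : ℤ, (W : ℚ) = w ∧ x₀ = (W : ℚ) ^ 2 ∧ y₀ = V * W ∧ W ≠ 0 ∧ V ≠ 0 ∧
      V ^ 2 = (W ^ 2) ^ 2 + 1470 * W ^ 2 - 8575 := by
  have hfin : ∀ R : (⟨0, 1470, 0, -8575, 0⟩ : WeierstrassCurve ℚ).toAffine.Point,
      IsOfFinAddOrder R := fun R => isOfFinAddOrder_of_finite R
  have hden : x₀.den = 1 :=
    Rat.den_eq_one_of_forall_norm_le_one fun p _ => norm_le_one_of_odd (hfin _) hodd p
  have hx₀Z : ((x₀.num : ℤ) : ℚ) = x₀ := Rat.coe_int_num_of_den_eq_one hden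
  have hwden : w.den = 1 := Rat.den_eq_one_of_sq_eq_intCast (n := x₀.num) (by rw [hx₀Z, hsq])
  have hwZ : ((w.num : ℤ) : ℚ) = w := Rat.coe_int_num_of_den_eq_one hwden
  have e₀ := rel h₀
  have hw0 : w ≠ 0 := by rintro rfl; exact hx₀ (by rw [hsq]; ring)
  have hv : (y₀ / w) ^ 2 = x₀ ^ 2 + 1470 * x₀ - 8575 := by
    rw [div_pow, div_eq_iff (pow_ne_zero 2 hw0)]
    linear_combination e₀ + (x₀ ^ 2 + 1470 * x₀ - 8575) * hsq
  have hvden : (y₀ / w).den = 1 :=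
    Rat.den_eq_one_of_sq_eq_intCast (n := x₀.num ^ 2 + 1470 * x₀.num - 8575) (by
      rw [hv]; push_cast; rw [hx₀Z])
  have hvZ : (((y₀ / w).num : ℤ) : ℚ) = y₀ / w := Rat.coe_int_num_of_den_eq_one hvden
  have hy₀0 : y₀ ≠ 0 := by
    intro hy0
    -- `y₀ = 0` would make `P₀` a `2`-torsion point, contradicting odd order
    have h2 : (.some x₀ y₀ h₀ : (⟨0, 1470, 0, -8575, 0⟩ : WeierstrassCurve ℚ).toAffine.Point) +
        .some x₀ y₀ h₀ = 0 :=
      Affine.Point.add_self_of_Y_eq (by rw [negY_eq, hy0, neg_zero])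
    have hdvd : addOrderOf
        (.some x₀ y₀ h₀ : (⟨0, 1470, 0, -8575, 0⟩ : WeierstrassCurve ℚ).toAffine.Point) ∣ 2 := by
      rw [addOrderOf_dvd_iff_nsmul_eq_zero, two_nsmul]; exact h2
    have hle := Nat.le_of_dvd two_pos hdvd
    have h1 : addOrderOf
        (.some x₀ y₀ h₀ : (⟨0, 1470, 0, -8575, 0⟩ : WeierstrassCurve ℚ).toAffine.Point) ≠ 1 := by
      rw [Ne, AddMonoid.addOrderOf_eq_one_iff]; exact Affine.Point.some_ne_zero h₀
    interval_cases hm : addOrderOf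
        (.some x₀ y₀ h₀ : (⟨0, 1470, 0, -8575, 0⟩ : WeierstrassCurve ℚ).toAffine.Point)
    · exact (hfin _).addOrderOf_pos.ne' hm
    · exact h1 rfl
    · exact absurd hodd (by decide)
  refine ⟨w.num, (y₀ / w).num, hwZ, by rw [hwZ, hsq], ?_, ?_, ?_, ?_⟩
  · rw [hvZ, hwZ, div_mul_cancel₀ _ hw0]
  · intro h0; apply hw0; rw [← hwZ, h0]; simp
  · intro h0
    have : y₀ / w = 0 := by rw [← hvZ, h0]; simp
    exact (div_ne_zero hy₀0 hw0) this
  · have : ((((y₀ / w).num : ℤ) : ℚ)) ^ 2 = (((w.num : ℤ) : ℚ) ^ 2) ^ 2 +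
        1470 * ((w.num : ℤ) : ℚ) ^ 2 - 8575 := by rw [hvZ, hv, hwZ, hsq]
    exact_mod_cast this

/-- **The rational points of `W⁵`: `Y² = X³ + 1470X² − 8575X` has only the affine solution
`(0, 0)`**, i.e. `W⁵(ℚ) = {O, T} ≅ ℤ/2` — the `5`-twist of Cremona `49a4` (conductor `1225`,
LMFDB `1225.c1`) has rank `0` and torsion `ℤ/2`.  This is the hypothesis `hQ5` of
`…CertB3E7MordellWeilQ.lean` (p677449) VERBATIM, now a theorem.  Proof: see the module docstring
(descent via `2`-isogeny + the tree's Mordell–Weil theorem for finiteness; `2Q ≠ T`; odd-order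
points are integral with square abscissa, and doubling once more forces `w ∣ 8575`, twelve
impossible cases). [cite: SilvermanAEC2009, X.4.9] -/
theorem ratPoints : ∀ X Y : ℚ, Y ^ 2 = X ^ 3 + 1470 * X ^ 2 - 8575 * X → X = 0 := by
  intro x y hxy
  haveI := isElliptic
  haveI := finite_point
  have hfin : ∀ R : (⟨0, 1470, 0, -8575, 0⟩ : WeierstrassCurve ℚ).toAffine.Point,
      IsOfFinAddOrder R := fun R => isOfFinAddOrder_of_finite R
  have hns : (⟨0, 1470, 0, -8575, 0⟩ : WeierstrassCurve ℚ).toAffine.Nonsingular x y :=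
    Affine.equation_iff_nonsingular.mp ((equation_iff x y).mpr hxy)
  obtain ⟨Q, hQ⟩ := exists_eq_add_self_or (.some x y hns)
  obtain ⟨P₀, hP₀⟩ : ∃ P₀ : (⟨0, 1470, 0, -8575, 0⟩ : WeierstrassCurve ℚ).toAffine.Point,
    P₀ = Q + Q := ⟨_, rfl⟩
  rw [← hP₀] at hQ
  have hodd : Odd (addOrderOf P₀) := hP₀ ▸ odd_addOrderOf_add_self Q
  -- `P₀ = O`
  have hcases : P₀ = 0 := by
    rcases hP : P₀ with _ | ⟨x₀, y₀, h₀⟩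
    · rfl
    exfalso
    rw [hP] at hP₀ hodd
    -- `Q = (x₁, y₁)` with `y₁ ≠ 0`, and `x₀ = x(2Q)` is a square
    rcases Q with _ | ⟨x₁, y₁, h₁⟩
    · rw [← Affine.Point.zero_def, add_zero] at hP₀
      exact absurd hP₀ (Affine.Point.some_ne_zero _)
    by_cases hy₁ : y₁ = (⟨0, 1470, 0, -8575, 0⟩ : WeierstrassCurve ℚ).toAffine.negY x₁ y₁
    · rw [Affine.Point.add_self_of_Y_eq hy₁] at hP₀
      exact absurd hP₀ (Affine.Point.some_ne_zero _)
    have key := addX_self_mul h₁ hy₁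
    rw [Affine.Point.add_self_of_Y_ne hy₁, Affine.Point.some.injEq] at hP₀
    rw [← hP₀.1] at key
    have hy₁0 : y₁ ≠ 0 := by
      intro h0; apply hy₁; rw [negY_eq, h0, neg_zero]
    obtain ⟨w, hw⟩ : ∃ w : ℚ, w = (x₁ ^ 2 + 8575) / (2 * y₁) := ⟨_, rfl⟩
    have hsq : x₀ = w ^ 2 := by
      rw [hw, div_pow, eq_div_iff (pow_ne_zero 2 (mul_ne_zero two_ne_zero hy₁0))]
      linear_combination key
    have hx₀0 : x₀ ≠ 0 := by
      rintro rfl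
      have hy₀ : y₀ = 0 := by simpa using rel h₀
      subst hy₀
      apply add_self_ne_T (.some x₁ y₁ h₁)
      rw [Affine.Point.add_self_of_Y_ne hy₁]
      exact (some_eq_some_of_eq _ hP₀.1 hP₀.2).choose_spec ▸ rfl
    -- integer coordinates `x₀ = W²`, `y₀ = V W`
    obtain ⟨W, V, hWw, hx₀W, hy₀VW, hW0, hV0, hVW⟩ := exists_int_coords_of_odd hodd hx₀0 hsq
    -- double once more: `2P₀` has odd order and abscissa `((x₀² + 8575)/(2y₀))²`
    have hy₀0 : y₀ ≠ 0 := by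
      rw [hy₀VW]; exact mul_ne_zero (by exact_mod_cast hV0) (by exact_mod_cast hW0)
    have hy₀ne : y₀ ≠ (⟨0, 1470, 0, -8575, 0⟩ : WeierstrassCurve ℚ).toAffine.negY x₀ y₀ := by
      rw [negY_eq]; intro h; apply hy₀0; linarith
    have key₂ := addX_self_mul h₀ hy₀ne
    obtain ⟨P₂, hP₂⟩ : ∃ P₂ : (⟨0, 1470, 0, -8575, 0⟩ : WeierstrassCurve ℚ).toAffine.Point,
        P₂ = (.some x₀ y₀ h₀ : (⟨0, 1470, 0, -8575, 0⟩ : WeierstrassCurve ℚ).toAffine.Point) +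
          .some x₀ y₀ h₀ := ⟨_, rfl⟩
    have hodd₂ : Odd (addOrderOf P₂) := hP₂ ▸ odd_addOrderOf_add_self _
    rcases hP2v : P₂ with _ | ⟨x₂, y₂, h₂⟩
    · rw [hP2v, Affine.Point.add_self_of_Y_ne hy₀ne] at hP₂
      exact absurd hP₂.symm (Affine.Point.some_ne_zero _)
    rw [hP2v] at hP₂ hodd₂
    rw [Affine.Point.add_self_of_Y_ne hy₀ne, Affine.Point.some.injEq] at hP₂
    rw [← hP₂.1] at key₂
    obtain ⟨t, ht⟩ : ∃ t : ℚ, t = (x₀ ^ 2 + 8575) / (2 * y₀) := ⟨_, rfl⟩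
    have hsq₂ : x₂ = t ^ 2 := by
      rw [ht, div_pow, eq_div_iff (pow_ne_zero 2 (mul_ne_zero two_ne_zero hy₀0))]
      linear_combination key₂
    have hden₂ : x₂.den = 1 :=
      Rat.den_eq_one_of_forall_norm_le_one fun p _ => norm_le_one_of_odd (hfin _) hodd₂ p
    have hx₂Z : ((x₂.num : ℤ) : ℚ) = x₂ := Rat.coe_int_num_of_den_eq_one hden₂
    have htden : t.den = 1 := Rat.den_eq_one_of_sq_eq_intCast (n := x₂.num) (by rw [hx₂Z, hsq₂])
    have htZ : ((t.num : ℤ) : ℚ) = t := Rat.coe_int_num_of_den_eq_one htden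
    -- the integer relation `t · (2 V W) = W⁴ + 8575`, whence `W ∣ 8575`
    have hrel : ((t.num : ℤ) : ℚ) * (2 * ((V : ℚ) * W)) = ((W : ℚ) ^ 2) ^ 2 + 8575 := by
      rw [htZ, ht, ← hy₀VW, ← hx₀W, div_mul_cancel₀ _ (mul_ne_zero two_ne_zero hy₀0)]
    have hrelZ : t.num * (2 * (V * W)) = (W ^ 2) ^ 2 + 8575 := by exact_mod_cast hrel
    have hdvd : W ∣ 8575 := by
      have h1 : W ∣ t.num * (2 * (V * W)) - (W ^ 2) ^ 2 :=
        dvd_sub ⟨t.num * (2 * V), by ring⟩ ⟨W ^ 3, by ring⟩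
      rw [hrelZ, add_sub_cancel_left] at h1
      exact h1
    exact quartic_ne_sq_of_dvd hdvd hVW
  -- conclusion
  rcases hQ with hPQ | hPQ
  · rw [hcases] at hPQ
    exact absurd hPQ (Affine.Point.some_ne_zero _)
  · rw [hcases, zero_add, Affine.Point.some.injEq] at hPQ
    exact hPQ.1

end Summit.Langlands.Langlands.Theorems.SqrtFiveQuarticCovers.W5Descent

end
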